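import Summits.KontsevichZagierPeriods.KontsevichZagierPeriods.Theorems.ComplexOrientationsCauchyMoveDisc
import Summits.KontsevichZagierPeriods.KontsevichZagierPeriods.Theorems.ComplexOrientationsCauchyMoveCircle

/-!
# Route `ComplexOrientations`, support item `CauchyMove` (stmt-KontsevichZagierPeriods-11370):
# the Cauchy move, part D4 — the `Re g · du` half of the boundary

Helper file (prover-owned, `--supports CauchyMove`), continuing parts D1 and D3. Preliminaries
on the parametrised circle inside the disc (`gamma_mem_disc`, semialgebraicity of
`s ↦ (Re γ, Im γ)`, `Re γ'`, `Im γ'`, continuity and a bound for `g ∘ γ`, integrability on `ℝ¹`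
from a `C/(1 + s²)` bound), and **theorem `boundaryP`**: with `rP = [ℝ, s ↦ Re g(γ s) · Re γ'(s)]`
and `rd = [τ, y ↦ Re g(y, b y) − Re g(y, −b y)]`, `[rP] + [rd] ∈ KZ.relations` — split
`ℝ = {s ≤ 0} ∪ {s ≥ 0}` (rule (1a)), substitute `y = Re γ(s)` on each half (rule (2) via `cov1`;
upper half-circle for `s ≥ 0`, lower for `s ≤ 0`, images identified by `u_inv`), add on `(-ρ, ρ]`
(rule (1b)) and compare with `rd` up to the null endpoint (rule (1a)).

Sources: Kontsevich–Zagier, *Periods* (2001), §1.2. Fully proved ([folklore]).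
-/

noncomputable section

open MvPolynomial Set Metric MeasureTheory
open Literature.ModelTheory.ExponentialFields Literature.NumberTheory.Transcendental
open Literature.NumberTheory.Transcendental.KZ

namespace Summit.KontsevichZagierPeriods.ComplexOrientations.CauchyMoveAux

/-- The complex number `x₀ + i x₁` attached to a point `x ∈ ℝ²` (local notation). -/
local notation:max "cx " x:max => (Complex.mk (x 0) (x 1))

/-- The complex number `x₁ + i x₀` attached to a point `x ∈ ℝ²` (swapped; local notation). -/
local notation:max "cxs " x:max => (Complex.mk (x 1) (x 0))

variable {ρ R' : ℝ} {g : ℂ → ℂ}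

/-! ### The boundary terms: matching the parametrised circle integral -/

section Boundary

/-- `γ(s) = ρ (1 + i s)/(1 - i s)` (local notation; `ρ` is the section variable). -/
local notation:max "γc " s:max => ((ρ : ℂ) * (1 + ((s : ℝ) : ℂ) * Complex.I) / (1 - ((s : ℝ) : ℂ) * Complex.I))

/-- `γ'(s) = 2 i ρ/(1 - i s)²` (local notation). -/
local notation:max "γc' " s:max => ((ρ : ℂ) * (2 * Complex.I) / (1 - ((s : ℝ) : ℂ) * Complex.I) ^ 2)

/-- The point `γ(s)` has coordinates `(Re γ, Im γ)` on the circle, inside the closed disc. -/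
theorem gamma_mem_disc (ρ s : ℝ) :
    (![((ρ : ℂ) * (1 + (s : ℂ) * Complex.I) / (1 - (s : ℂ) * Complex.I)).re,
      ((ρ : ℂ) * (1 + (s : ℂ) * Complex.I) / (1 - (s : ℂ) * Complex.I)).im] : Fin 2 → ℝ) ∈
      {x : Fin 2 → ℝ | x 0 ^ 2 + x 1 ^ 2 ≤ ρ ^ 2} := by
  show _ ^ 2 + _ ^ 2 ≤ ρ ^ 2
  simp only [Matrix.cons_val_zero, Matrix.cons_val_one, gamma_re, gamma_im]
  rw [u_sq_add_v_sq]

/-- `s ↦ (Re γ(s), Im γ(s))` is a `ℚ`-semialgebraic map on any `ℚ`-semialgebraic `A ⊆ ℝ¹`. -/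
theorem isSemialgebraicMapOn_gamma (halg : IsAlgebraic ℚ ρ) {A : Set (Fin 1 → ℝ)}
    (hA : IsSemialgebraic ℚ A) :
    IsSemialgebraicMapOn ℚ A fun z : Fin 1 → ℝ => (![(γc (z 0)).re, (γc (z 0)).im] : Fin 2 → ℝ) := by
  have hd : ∀ z : Fin 1 → ℝ, aeval z (1 + X 0 ^ 2 : MvPolynomial (Fin 1) ℚ) ≠ 0 := fun z => by
    simp; positivity
  have hc := isSemialgebraicFunOn_const_of_isAlgebraic hA halg
  refine IsSemialgebraicMapOn.of_forall hA fun j => ?_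
  fin_cases j
  · refine (IsSemialgebraicFunOn.mul_holds hc (isSemialgebraicFunOn_aeval_div_aeval hA
      (1 - X 0 ^ 2) (1 + X 0 ^ 2) fun z _ => hd z)).congr fun z _ => ?_
    simp [gamma_re]; ring
  · refine (IsSemialgebraicFunOn.mul_holds hc (isSemialgebraicFunOn_aeval_div_aeval hA
      (2 * X 0) (1 + X 0 ^ 2) fun z _ => hd z)).congr fun z _ => ?_
    simp [gamma_im]; ring

/-- `s ↦ Re γ'(s)` is `ℚ`-semialgebraic. -/
theorem isSemialgebraicFunOn_gamma'_re (halg : IsAlgebraic ℚ ρ) {A : Set (Fin 1 → ℝ)}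
    (hA : IsSemialgebraic ℚ A) : IsSemialgebraicFunOn ℚ A fun z : Fin 1 → ℝ => (γc' (z 0)).re := by
  have hd : ∀ z : Fin 1 → ℝ, aeval z ((1 + X 0 ^ 2) ^ 2 : MvPolynomial (Fin 1) ℚ) ≠ 0 := fun z => by
    simp; positivity
  refine (IsSemialgebraicFunOn.mul_holds (isSemialgebraicFunOn_const_of_isAlgebraic hA halg)
    (isSemialgebraicFunOn_aeval_div_aeval hA (-4 * X 0) ((1 + X 0 ^ 2) ^ 2) fun z _ => hd z)).congr
    fun z _ => ?_
  simp [gamma'_re]; ring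

/-- `s ↦ Im γ'(s)` is `ℚ`-semialgebraic. -/
theorem isSemialgebraicFunOn_gamma'_im (halg : IsAlgebraic ℚ ρ) {A : Set (Fin 1 → ℝ)}
    (hA : IsSemialgebraic ℚ A) : IsSemialgebraicFunOn ℚ A fun z : Fin 1 → ℝ => (γc' (z 0)).im := by
  have hd : ∀ z : Fin 1 → ℝ, aeval z ((1 + X 0 ^ 2) ^ 2 : MvPolynomial (Fin 1) ℚ) ≠ 0 := fun z => by
    simp; positivity
  refine (IsSemialgebraicFunOn.mul_holds (isSemialgebraicFunOn_const_of_isAlgebraic hA halg)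
    (isSemialgebraicFunOn_aeval_div_aeval hA (2 * (1 - X 0 ^ 2)) ((1 + X 0 ^ 2) ^ 2)
      fun z _ => hd z)).congr fun z _ => ?_
  simp [gamma'_im]; ring

variable {G : (Fin 2 → ℝ) → ℝ}

/-- Composition of a semialgebraic function on the disc with the parametrisation. -/
theorem isSemialgebraicFunOn_comp_gamma (halg : IsAlgebraic ℚ ρ) {A : Set (Fin 1 → ℝ)}
    (hA : IsSemialgebraic ℚ A)
    (hG : IsSemialgebraicFunOn ℚ {x : Fin 2 → ℝ | x 0 ^ 2 + x 1 ^ 2 ≤ ρ ^ 2} G) :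
    IsSemialgebraicFunOn ℚ A fun z : Fin 1 → ℝ =>
      G ![(γc (z 0)).re, (γc (z 0)).im] :=
  IsSemialgebraicFunOn.comp_isSemialgebraicMapOn_holds hG (isSemialgebraicMapOn_gamma halg hA)
    fun z _ => gamma_mem_disc ρ (z 0)

/-- `γ(s)` recovered from its real and imaginary parts. -/
theorem cx_gamma (ρ s : ℝ) :
    (⟨(![((ρ : ℂ) * (1 + (s : ℂ) * Complex.I) / (1 - (s : ℂ) * Complex.I)).re,
      ((ρ : ℂ) * (1 + (s : ℂ) * Complex.I) / (1 - (s : ℂ) * Complex.I)).im] : Fin 2 → ℝ) 0,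
      (![((ρ : ℂ) * (1 + (s : ℂ) * Complex.I) / (1 - (s : ℂ) * Complex.I)).re,
      ((ρ : ℂ) * (1 + (s : ℂ) * Complex.I) / (1 - (s : ℂ) * Complex.I)).im] : Fin 2 → ℝ) 1⟩ : ℂ) =
      (ρ : ℂ) * (1 + (s : ℂ) * Complex.I) / (1 - (s : ℂ) * Complex.I) :=
  Complex.ext rfl rfl

/-- `γ(s)` lies in any open disc of radius `R' > ρ`. -/
theorem gamma_mem_ball (hρ : 0 < ρ) (hR : ρ < R') (s : ℝ) :
    (ρ : ℂ) * (1 + (s : ℂ) * Complex.I) / (1 - (s : ℂ) * Complex.I) ∈ ball (0 : ℂ) R' := by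
  rw [← cx_gamma]
  exact cx_mem_ball_of_mem_disc hρ hR (gamma_mem_disc ρ s)

/-- `s ↦ g (γ s)` is continuous. -/
theorem continuous_g_gamma (hρ : 0 < ρ) (hR : ρ < R') (hg : DifferentiableOn ℂ g (ball 0 R')) :
    Continuous fun s : ℝ => g (γc s) := by
  refine hg.continuousOn.comp_continuous ?_ (gamma_mem_ball hρ hR)
  refine Continuous.div (by fun_prop) (by fun_prop) fun s => one_sub_mul_I_ne_zero s

/-- A bound for `g` on the circle. -/
theorem exists_bound_g_gamma (hρ : 0 < ρ) (hR : ρ < R') (hg : DifferentiableOn ℂ g (ball 0 R')) :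
    ∃ M, ∀ s : ℝ, ‖g (γc s)‖ ≤ M := by
  obtain ⟨M, hM⟩ := (isCompact_disc ρ).exists_bound_of_continuousOn (continuousOn_g_cx hρ hR hg)
  refine ⟨M, fun s => ?_⟩
  have := hM _ (gamma_mem_disc ρ s)
  rwa [cx_gamma] at this

/-- Integrability on `ℝ¹` of a continuous function dominated by `C/(1 + s²)`. -/
theorem integrable_fin1 {F : ℝ → ℝ} (hF : Continuous F) {C : ℝ}
    (hb : ∀ s, |F s| ≤ C / (1 + s ^ 2)) :
    Integrable (fun z : Fin 1 → ℝ => F (z 0)) := by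
  have h1 : Integrable F := by
    refine Integrable.mono' (integrable_inv_one_add_sq.const_mul C) hF.aestronglyMeasurable
      (Filter.Eventually.of_forall fun s => ?_)
    rw [Real.norm_eq_abs, ← div_eq_mul_inv]
    exact hb s
  have := ((volume_preserving_funUnique (Fin 1) ℝ).integrable_comp_emb
    (MeasurableEquiv.funUnique (Fin 1) ℝ).measurableEmbedding).2 h1
  exact this


/-- Semialgebraicity of the edge maps `y ↦ (y, ±√(ρ² - y²))` of the disc over a subset of `τ`. -/
theorem isSemialgebraicMapOn_edge (halg : IsAlgebraic ℚ ρ) {E : Set (Fin 1 → ℝ)}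
    (hE : IsSemialgebraic ℚ E) (σ : ℝ) (hσ : σ = 1 ∨ σ = -1) :
    IsSemialgebraicMapOn ℚ E fun y : Fin 1 → ℝ => (![y 0, σ * √(ρ ^ 2 - y 0 ^ 2)] : Fin 2 → ℝ) := by
  have hsq : IsSemialgebraicFunOn ℚ E fun y : Fin 1 → ℝ => √(ρ ^ 2 - y 0 ^ 2) :=
    IsSemialgebraicFunOn.sqrt_holds (IsSemialgebraicFunOn.sub_holds
      (isSemialgebraicFunOn_const_of_isAlgebraic hE (halg.pow 2))
      ((isSemialgebraicFunOn_aeval hE (X 0 ^ 2)).congr fun u _ => by simp))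
  refine IsSemialgebraicMapOn.of_forall hE fun j => ?_
  fin_cases j
  · exact (isSemialgebraicFunOn_aeval hE (X 0)).congr fun u _ => by simp
  · rcases hσ with rfl | rfl
    · simpa using hsq
    · exact hsq.neg.congr fun u _ => by simp

/-- **The `Re g · du` half of the boundary.** With `rP = [ℝ, s ↦ Re g(γ s) · Re γ'(s)]` and
`rd = [τ, y ↦ Re g(y, b y) − Re g(y, −b y)]` (`b y = √(ρ² − y²)`), `[rP] + [rd] ∈ KZ.relations`:
split `ℝ = {s ≤ 0} ∪ {s ≥ 0}` (rule (1a)), substitute `y = Re γ(s)` on each half (rule (2); upper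
half-circle for `s ≥ 0`, lower for `s ≤ 0`), add the two integrands on `(-ρ, ρ]` (rule (1b)) and
compare with `rd` up to the null endpoint `{-ρ}` (rule (1a)). -/
theorem boundaryP (hρ : 0 < ρ) (halg : IsAlgebraic ℚ ρ) (hR : ρ < R')
    (hg : DifferentiableOn ℂ g (ball 0 R'))
    (hPs : IsSemialgebraicFunOn ℚ {x : Fin 2 → ℝ | x 0 ^ 2 + x 1 ^ 2 ≤ ρ ^ 2}
      (fun x => (g (cx x)).re))
    (rP : IntegralRep 1) (hPd : rP.domain = univ)
    (hPi : ∀ z, rP.integrand z = (g (γc (z 0))).re * (γc' (z 0)).re)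
    (rd : IntegralRep 1) (hdd : rd.domain = {u : Fin 1 → ℝ | u 0 ^ 2 ≤ ρ ^ 2})
    (hdi : rd.integrand = fun u => (g ⟨u 0, √(ρ ^ 2 - u 0 ^ 2)⟩).re -
        (g ⟨u 0, -√(ρ ^ 2 - u 0 ^ 2)⟩).re) :
    of rP + of rd ∈ relations := by
  set τ : Set (Fin 1 → ℝ) := {u | u 0 ^ 2 ≤ ρ ^ 2} with hτ
  set D : Set (Fin 2 → ℝ) := {x | x 0 ^ 2 + x 1 ^ 2 ≤ ρ ^ 2} with hD
  have hτs : IsSemialgebraic ℚ τ := isSemialgebraic_tau halg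
  have hτc : IsCompact τ := isCompact_tau ρ
  -- the two halves of the parameter line
  set Ap : Set (Fin 1 → ℝ) := {z | 0 ≤ z 0} with hAp
  set Am : Set (Fin 1 → ℝ) := {z | z 0 ≤ 0} with hAm
  have hAps : IsSemialgebraic ℚ Ap := by
    simpa using isSemialgebraic_setOf_eval_nonneg (k := ℚ) (R := ℝ) (X 0 : MvPolynomial (Fin 1) ℚ)
  have hAms : IsSemialgebraic ℚ Am := by
    simpa using isSemialgebraic_setOf_eval_nonneg (k := ℚ) (R := ℝ) (-X 0 : MvPolynomial (Fin 1) ℚ)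
  have hApsub : Ap ⊆ rP.domain := by rw [hPd]; exact subset_univ _
  have hAmsub : Am ⊆ rP.domain := by rw [hPd]; exact subset_univ _
  set rPp := rP.restrict Ap hAps hApsub with hrPp
  set rPm := rP.restrict Am hAms hAmsub with hrPm
  have h1a : of rP - of rPm - of rPp ∈ relations := by
    refine domainAddRel_subset_relations ⟨1, rP, rPm, rPp, ?_, ?_, fun _ _ => rfl, fun _ _ => rfl, rfl⟩
    · rw [hPd]; ext z
      simp only [mem_univ, true_iff, mem_union]
      exact le_total (z 0) 0
    · refine measure_mono_null (fun z hz => ?_) (volume_setOf_last_eq_zero (n := 0) 0)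
      simp only [mem_inter_iff] at hz
      show z 0 = 0
      exact le_antisymm hz.1 hz.2
  -- the common target domain `E = (-ρ, ρ]`
  set E : Set (Fin 1 → ℝ) := {y | -ρ < y 0 ∧ y 0 ≤ ρ} with hE
  have hEs : IsSemialgebraic ℚ E := by
    have h1 := (IsSemialgebraicFunOn.sub_holds
      ((isSemialgebraicFunOn_const_of_isAlgebraic isSemialgebraic_univ halg).neg)
      (isSemialgebraicFunOn_aeval (isSemialgebraic_univ) (X 0 : MvPolynomial (Fin 1) ℚ))
      ).isSemialgebraic_sep_neg
    have h2 := (IsSemialgebraicFunOn.sub_holds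
      (isSemialgebraicFunOn_const_of_isAlgebraic isSemialgebraic_univ halg)
      (isSemialgebraicFunOn_aeval (isSemialgebraic_univ) (X 0 : MvPolynomial (Fin 1) ℚ))
      ).isSemialgebraic_sep_nonneg
    convert h1.inter h2 using 1
    ext y
    simp only [hE, mem_setOf_eq, mem_inter_iff, mem_univ, true_and, Pi.sub_apply, Pi.neg_apply,
      aeval_X, sub_neg, sub_nonneg]
  have hEτ : E ⊆ τ := fun y hy => by
    show y 0 ^ 2 ≤ ρ ^ 2; simp only [hE, mem_setOf_eq] at hy; nlinarith
  have hEsq : ∀ y ∈ E, y 0 ^ 2 ≤ ρ ^ 2 := fun y hy => hEτ hy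
  -- edge maps and the target integrands
  have hedge : ∀ σ : ℝ, σ = 1 ∨ σ = -1 → MapsTo
      (fun y : Fin 1 → ℝ => (![y 0, σ * √(ρ ^ 2 - y 0 ^ 2)] : Fin 2 → ℝ)) τ D := by
    intro σ hσ y hy
    have hσ2 : σ ^ 2 = 1 := by rcases hσ with rfl | rfl <;> norm_num
    show y 0 ^ 2 + (σ * √(ρ ^ 2 - y 0 ^ 2)) ^ 2 ≤ ρ ^ 2
    rw [mul_pow, hσ2, one_mul, Real.sq_sqrt (by simp only [hτ, mem_setOf_eq] at hy; linarith)]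
    linarith
  have hsa_edge : ∀ σ : ℝ, σ = 1 ∨ σ = -1 →
      IsSemialgebraicFunOn ℚ E fun y => (g ⟨y 0, σ * √(ρ ^ 2 - y 0 ^ 2)⟩).re := fun σ hσ =>
    (IsSemialgebraicFunOn.comp_isSemialgebraicMapOn_holds hPs (isSemialgebraicMapOn_edge halg hEs σ hσ)
      ((hedge σ hσ).mono_left hEτ)).congr fun y _ => rfl
  have hcont_edge : ∀ σ : ℝ, σ = 1 ∨ σ = -1 →
      ContinuousOn (fun y : Fin 1 → ℝ => (g ⟨y 0, σ * √(ρ ^ 2 - y 0 ^ 2)⟩).re) τ := by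
    intro σ hσ
    have hm : Continuous fun y : Fin 1 → ℝ => (![y 0, σ * √(ρ ^ 2 - y 0 ^ 2)] : Fin 2 → ℝ) := by
      refine continuous_pi fun i => ?_
      fin_cases i
      · exact continuous_apply 0
      · exact (continuous_const.mul ((continuous_const.sub ((continuous_apply 0).pow 2)).sqrt))
    exact (Complex.continuous_re.comp_continuousOn
      ((continuousOn_g_cx hρ hR hg).comp hm.continuousOn (hedge σ hσ))).congr fun y _ => rfl
  have hint_edge : ∀ σ : ℝ, σ = 1 ∨ σ = -1 →
      IntegrableOn (fun y : Fin 1 → ℝ => (g ⟨y 0, σ * √(ρ ^ 2 - y 0 ^ 2)⟩).re) E := fun σ hσ =>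
    ((hcont_edge σ hσ).integrableOn_compact hτc).mono_set hEτ
  let rPp' : IntegralRep 1 := ⟨E, fun y => -(g ⟨y 0, 1 * √(ρ ^ 2 - y 0 ^ 2)⟩).re, hEs,
    (hsa_edge 1 (Or.inl rfl)).neg, (hint_edge 1 (Or.inl rfl)).neg⟩
  let rPm' : IntegralRep 1 := ⟨E, fun y => (g ⟨y 0, (-1) * √(ρ ^ 2 - y 0 ^ 2)⟩).re, hEs,
    hsa_edge (-1) (Or.inr rfl), hint_edge (-1) (Or.inr rfl)⟩
  -- facts about `u = Re γ`
  have hU : ∀ s : ℝ, (γc s).re = ρ * (1 - s ^ 2) / (1 + s ^ 2) := fun s => gamma_re ρ s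
  have hV : ∀ s : ℝ, (γc s).im = 2 * ρ * s / (1 + s ^ 2) := fun s => gamma_im ρ s
  have hU' : ∀ s : ℝ, (γc' s).re = -4 * ρ * s / (1 + s ^ 2) ^ 2 := fun s => gamma'_re ρ s
  have hcirc : ∀ s : ℝ, (γc s).re ^ 2 + (γc s).im ^ 2 = ρ ^ 2 := fun s => by
    rw [hU, hV]; exact u_sq_add_v_sq ρ s
  have hsaU : ∀ {A : Set (Fin 1 → ℝ)}, IsSemialgebraic ℚ A →
      IsSemialgebraicFunOn ℚ A fun z => (γc (z 0)).re := fun hA =>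
    ((isSemialgebraicMapOn_iff_forall_holds hA).1 (isSemialgebraicMapOn_gamma halg hA) 0).congr
      fun z _ => by simp
  have himage : ∀ (σ : ℝ), (σ = 1 ∨ σ = -1) →
      E = (fun z : Fin 1 → ℝ => fun _ : Fin 1 => (γc (z 0)).re) '' {z | 0 ≤ σ * z 0} := by
    intro σ hσ
    ext y
    constructor
    · intro hy
      refine ⟨fun _ => σ * √((ρ - y 0) / (ρ + y 0)), ?_, ?_⟩
      · show 0 ≤ σ * (σ * √((ρ - y 0) / (ρ + y 0)))
        have hσ2 : σ * σ = 1 := by rcases hσ with rfl | rfl <;> norm_num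
        rw [← mul_assoc, hσ2, one_mul]; exact Real.sqrt_nonneg _
      · funext i
        beta_reduce
        rw [hU, mul_pow, show σ ^ 2 = 1 by rcases hσ with rfl | rfl <;> norm_num, one_mul,
          Subsingleton.elim i 0]
        exact u_inv hρ hy.1 hy.2
    · rintro ⟨z, -, rfl⟩
      show -ρ < (γc (z 0)).re ∧ (γc (z 0)).re ≤ ρ
      rw [hU]; exact u_bounds hρ (z 0)
  -- the two substitutions
  have hcovp : of rPp - of rPp' ∈ relations := by
    refine cov1 rPp rPp' (fun s => (γc s).re) (fun s => (γc' s).re) (hsaU hAps)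
      (fun z _ => hasDerivAt_gamma_re ρ (z 0)) (fun z hz z' hz' h => ?_) ?_ (fun z hz => ?_)
    · rw [hU, hU] at h
      have h2 := sq_eq_of_u_eq hρ.ne' h
      have hz0 : 0 ≤ z 0 := hz; have hz0' : 0 ≤ z' 0 := hz'
      nlinarith
    · show E = _
      convert himage 1 (Or.inl rfl) using 2
      show Ap = _
      ext z; simp [hAp]
    · have hz0 : 0 ≤ z 0 := hz
      show rP.integrand z = -(g ⟨(γc (z 0)).re, 1 * √(ρ ^ 2 - (γc (z 0)).re ^ 2)⟩).re * |(γc' (z 0)).re|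
      have him : 0 ≤ (γc (z 0)).im := by rw [hV]; positivity
      have hpt : (⟨(γc (z 0)).re, 1 * √(ρ ^ 2 - (γc (z 0)).re ^ 2)⟩ : ℂ) = γc (z 0) :=
        Complex.ext rfl (by rw [one_mul]; exact (eq_sqrt_of_sq_add_sq (hcirc (z 0)) him).symm)
      have hder : (γc' (z 0)).re ≤ 0 := by
        rw [hU']; exact div_nonpos_of_nonpos_of_nonneg (by nlinarith) (by positivity)
      rw [hpt, abs_of_nonpos hder, hPi]
      ring
  have hcovm : of rPm - of rPm' ∈ relations := by
    refine cov1 rPm rPm' (fun s => (γc s).re) (fun s => (γc' s).re) (hsaU hAms)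
      (fun z _ => hasDerivAt_gamma_re ρ (z 0)) (fun z hz z' hz' h => ?_) ?_ (fun z hz => ?_)
    · rw [hU, hU] at h
      have h2 := sq_eq_of_u_eq hρ.ne' h
      have hz0 : z 0 ≤ 0 := hz; have hz0' : z' 0 ≤ 0 := hz'
      nlinarith
    · show E = _
      convert himage (-1) (Or.inr rfl) using 2
      show Am = _
      ext z; simp [hAm]
    · have hz0 : z 0 ≤ 0 := hz
      show rP.integrand z = (g ⟨(γc (z 0)).re, (-1) * √(ρ ^ 2 - (γc (z 0)).re ^ 2)⟩).re * |(γc' (z 0)).re|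
      have him : (γc (z 0)).im ≤ 0 := by
        rw [hV]; exact div_nonpos_of_nonpos_of_nonneg (by nlinarith) (by positivity)
      have hpt : (⟨(γc (z 0)).re, (-1) * √(ρ ^ 2 - (γc (z 0)).re ^ 2)⟩ : ℂ) = γc (z 0) :=
        Complex.ext rfl (by rw [neg_one_mul]; exact (eq_neg_sqrt_of_sq_add_sq (hcirc (z 0)) him).symm)
      have hder : 0 ≤ (γc' (z 0)).re := by
        rw [hU']; exact div_nonneg (by nlinarith) (by positivity)
      rw [hpt, abs_of_nonneg hder, hPi]
  -- adding the two halves on `E` and comparing with `rd`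
  let rE : IntegralRep 1 := ⟨E, rPp'.integrand + rPm'.integrand, hEs,
    IsSemialgebraicFunOn.add_holds rPp'.isSemialgebraicFunOn_integrand rPm'.isSemialgebraicFunOn_integrand,
    rPp'.integrableOn.add rPm'.integrableOn⟩
  have h1b : of rE - of rPp' - of rPm' ∈ relations :=
    integrandAddRel_subset_relations ⟨1, rE, rPp', rPm', rfl, rfl, fun _ _ => rfl, rfl⟩
  have hEsub : E ⊆ rd.domain := by rw [hdd]; exact hEτ
  set rdE := rd.restrict E hEs hEsub with hrdE
  have hres : of rd - of rdE ∈ relations := by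
    refine rd.of_sub_of_restrict_mem_relations hEs hEsub
      (measure_mono_null (fun y hy => ?_) (volume_setOf_last_eq_zero (n := 0) (-ρ)))
    rw [hdd] at hy
    obtain ⟨hy1, hy2⟩ := hy
    simp only [hτ, hE, mem_setOf_eq, not_and, not_le] at hy1 hy2
    show y 0 = -ρ
    obtain ⟨h1, h2⟩ := abs_le_of_sq_le_sq' hy1 hρ.le
    rcases h1.lt_or_eq with h1 | h1
    · exact absurd h2 (not_le.2 (hy2 h1))
    · exact h1.symm
  have hneg : of rdE + of rE ∈ relations := by
    refine of_add_of_mem_relations_of_eqOn_neg rfl fun y _ => ?_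
    show -(g ⟨y 0, 1 * √(ρ ^ 2 - y 0 ^ 2)⟩).re + (g ⟨y 0, (-1) * √(ρ ^ 2 - y 0 ^ 2)⟩).re =
      -rd.integrand y
    rw [hdi, one_mul, neg_one_mul]
    ring
  have : of rP + of rd = (of rP - of rPm - of rPp) + (of rPp - of rPp') + (of rPm - of rPm') -
      (of rE - of rPp' - of rPm') + (of rdE + of rE) + (of rd - of rdE) := by abel
  rw [this]
  refine relations.add_mem (relations.add_mem (relations.sub_mem (relations.add_mem
    (relations.add_mem h1a hcovp) hcovm) h1b) hneg) hres

end Boundary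

end Summit.KontsevichZagierPeriods.ComplexOrientations.CauchyMoveAux
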